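import Literature.IUT.LogVolume.ProductVolume
import Literature.IUT.LogVolume.LocalFieldVolume
import Literature.IUT.LogVolume.HolomorphicHull
import HarnessLib

/-!
# Packet-normalised log-volumes on a direct sum of local fields; volumes of hulls; processions

The local holomorphic tensor packets of [IUTchIII] Prop. 3.1/3.9 and the tensor products `⊗_{i∈E} k_i`
of [IUTchIV] Prop. 1.4 (i) are, as topological rings, finite DIRECT SUMS `L = ⊕_j K_j` of
nonarchimedean local fields ([IUTchIV] Prop. 1.4 (i): "tensor products of finitely many finite
extensions of `ℚ_p` over `ℤ_p` decompose, naturally, as direct sums of finitely many finite extensions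
of `ℚ_p`"; [IUTchIII] Rmk. 3.9.1 (i): "`I^ℚ(^αF_{v_ℚ}) ≅ ⊕_{i=1}^{n_{v_ℚ}} k_i`"), with integral
structure `O_L = ∏_j O_{K_j}` and the packet-normalised (weighted) log-volume of [IUTchIII] Prop. 3.9
(i) (kurims p. 115): "log-volumes `μ^log : M(I^ℚ(−)) → ℝ` … such that the log-volume of each of the
"local holomorphic" integral structures … is equal to zero. Here, we assume that these log-volumes are
normalized so that multiplication of an element of "M(−)" by `p_v` corresponds to adding the quantity
`−log(p_v) ∈ ℝ`; we shall refer to this normalization as the packet-normalization. … Finally, when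
working with collections of capsules in a procession, … we obtain … log-volumes on the products of the
"M(−)" associated to the various capsules …, which we normalize by taking the average, over the
various capsules; we shall refer to this normalization as the procession-normalization".

This file specialises `ProductVolume.lean` (weighted log-volumes of direct product regions) to
`L = Π j, K j` with the local fields of `LocalFieldVolume.lean` and the hulls of `HolomorphicHull.lean`:

* `piUnitBallStructure K` (`= ∏ O_{K_j}`), `piVolume K`, box formula `piVolume_polydisc`;
* hull sets `λ·O_L` are direct product regions (`isDirectProductRegion_hullSet`) and their weighted
  log-volume is `Σ_j w_j · μ̇^log_{K_j}(λ_j)` (`weightedLogVolume_hullSet`) — the quantity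
  "log-volume of the holomorphic hull" of [IUTchIII] Cor. 3.12 is thereby an explicit finite sum;
* scaling of a direct product region by units `x = (x_j)`: `+ Σ_j w_j μ̇^log_{K_j}(x_j)`
  (`weightedLogVolume_units_smul`), `μ̇^log` depends only on the norm (`mulLogVolume_eq_of_norm_eq`),
  `μ̇^log(x) = −n·log q` when `‖x‖ = ‖ϖ‖ⁿ`;
* **packet-normalisation** (`weightedLogVolume_natCast_smul`): with `‖p‖_{K_j} = ‖ϖ_j‖^{e_j}`,
  `q_j = p^{f_j}` and weights satisfying `Σ_j w_j e_j f_j = 1`, multiplying every factor by `p`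
  subtracts exactly `log p`;
* **procession-normalisation**: the average `processionAverage` over the capsules of a procession, its
  invariance under relabelling (`processionAverage_comp_equiv`, "well-defined") and its compatibility
  with the packet-normalisation (`processionAverage_const`).
[cite: Mochizuki2012, IUTchIII Prop. 3.9 (i) pp. 115–116; IUTchIV Prop. 1.4 (i) p. 13]
Deliberately NOT here: the identification `⊗ k_i ≅ ⊕ L_j` itself (tensor-packet ring, S1's files), the
`E`-weighted measure on arbitrary Borel sets, archimedean factors, any judgement on Cor. 3.12.
-/

noncomputable section

open MeasureTheory MeasureTheory.Measure Set Metric TopologicalSpace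
open scoped ENNReal NNReal Pointwise NormedField
open Literature.NumberTheory.GaloisRepresentations.Ultrametric

namespace Literature.IUT.LogVolume

variable {J : Type*} [Fintype J] (K : J → Type*) [∀ j, NontriviallyNormedField (K j)]
  [∀ j, IsUltrametricDist (K j)] [∀ j, ProperSpace (K j)]

/-! ### The direct sum `⊕_j K_j` with integral structure `∏_j O_{K_j}` -/

/-- `O_L = ∏_j O_{K_j}` as an integral structure on `L = ⊕_j K_j` ("the integral structures … on each of
the direct summand `p_{v_ℚ}`-adic fields"). [cite: Mochizuki2012, IUTchIII Prop. 3.9 (i) p. 115] -/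
def piUnitBallStructure : IntegralStructure (Π j, K j) :=
  IntegralStructure.pi (fun j => unitBallStructure (K j))

/-- `O_L` as a set is the unit polydisc `∏ closedBall 0 1`. [cite: Mochizuki2012, IUTchIII Prop. 3.9 (i) p. 115] -/
@[simp] theorem coe_piUnitBallStructure :
    (piUnitBallStructure K : Set (Π j, K j)) = polydisc K (fun _ => 1) := by
  simp [piUnitBallStructure, polydisc]

variable [∀ j, MeasurableSpace (K j)] [∀ j, BorelSpace (K j)]

/-- The volume on `L = ⊕_j K_j` normalised by `μ(O_L) = 1`. [cite: Mochizuki2012, IUTchIII Prop. 3.9 (i) p. 115] -/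
def piVolume : Measure (Π j, K j) := (piUnitBallStructure K).haar

/-- `μ(O_L) = 1`. [cite: Mochizuki2012, IUTchIII Prop. 3.9 (i) p. 115] -/
@[simp] theorem piVolume_unitPolydisc : piVolume K (polydisc K (fun _ => 1)) = 1 := by
  rw [← coe_piUnitBallStructure]
  exact (piUnitBallStructure K).haar_self

/-- `μ` on `L` is the product of the `μ_{K_j}`. [cite: Mochizuki2012, IUTchIII Rmk. 3.1.1 (iii) p. 95] -/
theorem piVolume_eq_pi : piVolume K = Measure.pi (fun j => localVolume (K j)) :=
  IntegralStructure.pi_haar_eq _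

/-- **Box formula for polydiscs**: `μ(∏ closedBall 0 r_j) = ∏_j μ_{K_j}(closedBall 0 r_j)`.
[cite: Mochizuki2012, IUTchIII Rmk. 3.1.1 (iii) p. 95] -/
theorem piVolume_polydisc (r : J → ℝ) :
    piVolume K (polydisc K r) = ∏ j, localVolume (K j) (closedBall (0 : K j) (r j)) :=
  IntegralStructure.pi_haar_pi _ _

/-! ### Hull sets are direct product regions; their weighted log-volumes -/

omit [Fintype J] [∀ j, MeasurableSpace (K j)] [∀ j, BorelSpace (K j)] in
/-- A closed ball of positive radius in a local field is compact and open.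
[cite: MochizukiAbsTopIII2015, Prop. 5.7 (i)(a) p. 137] -/
theorem isCompact_isOpen_closedBall (j : J) {r : ℝ} (hr : 0 < r) :
    IsCompact (closedBall (0 : K j) r) ∧ IsOpen (closedBall (0 : K j) r) :=
  ⟨isCompact_closedBall 0 r, IsUltrametricDist.isOpen_closedBall _ hr.ne'⟩

omit [Fintype J] in
/-- A closed ball of positive radius has positive volume.
[cite: MochizukiAbsTopIII2015, Prop. 5.7 (i)(a) p. 137] -/
theorem localVolume_closedBall_pos (j : J) {r : ℝ} (hr : 0 < r) :
    0 < localVolume (K j) (closedBall (0 : K j) r) :=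
  (isCompact_isOpen_closedBall K j hr).2.measure_pos _ ⟨0, by simp [hr.le]⟩

omit [Fintype J] in
/-- **Hull sets are direct product regions** ("`H ⊆ P`", [IUTchIII] Rmk. 3.9.5 (ii)): the factors
`closedBall 0 ‖λ_j‖` (`λ_j ≠ 0`) are compact of positive volume.
[cite: Mochizuki2012, IUTchIII Rmk. 3.9.5 (ii) p. 127] -/
theorem isDirectProductRegion_hullSet (c : Π j, K j) (hc : ∀ j, c j ≠ 0) :
    IntegralStructure.IsDirectProductRegion (fun j => unitBallStructure (K j))
      (fun j => closedBall (0 : K j) ‖c j‖) :=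
  ⟨fun _ => isCompact_closedBall 0 _,
    fun j => localVolume_closedBall_pos K j (norm_pos_iff.mpr (hc j))⟩

omit [Fintype J] in
/-- `μ^log_{K_j}(closedBall 0 ‖x‖) = μ̇^log_{K_j}(x)` for a unit `x`.
[cite: MochizukiAbsTopIII2015, Prop. 5.7 (i)(b) p. 138] -/
theorem localLogVolume_closedBall_norm (j : J) (x : (K j)ˣ) :
    localLogVolume (K j) (closedBall (0 : K j) ‖(x : K j)‖) = mulLogVolume (K j) x := by
  rw [mulLogVolume, mulVolume, units_smul_unitBall, localLogVolume_eq_log]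

/-- **Weighted log-volume of a hull set**: `Σ_j w_j · μ̇^log_{K_j}(λ_j)` — the "log-volume of the
holomorphic hull" as an explicit finite sum. [cite: Mochizuki2012, IUTchIII Rmk. 3.9.5 (iii) p. 128] -/
theorem weightedLogVolume_hullSet (w : J → ℝ) (c : Π j, (K j)ˣ) :
    IntegralStructure.weightedLogVolume (fun j => unitBallStructure (K j)) w
      (fun j => closedBall (0 : K j) ‖(c j : K j)‖) = ∑ j, w j * mulLogVolume (K j) (c j) := by
  simp only [IntegralStructure.weightedLogVolume_eq_sum]
  refine Finset.sum_congr rfl fun j _ => ?_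
  rw [← localLogVolume_closedBall_norm]
  rfl

/-! ### Scaling by units, `μ̇^log` as a function of the norm, packet-normalisation -/

/-- **Scaling a direct product region by units**: the weighted log-volume of `(x_j·A_j)_j` is that of
`A` plus `Σ_j w_j · μ̇^log_{K_j}(x_j)` ([AbsTopIII] 5.7 (i)(b) factor by factor).
[cite: Mochizuki2012, IUTchIII Rmk. 3.1.1 (ii) p. 94] -/
theorem weightedLogVolume_units_smul (w : J → ℝ) (x : Π j, (K j)ˣ) {A : Π j, Set (K j)}
    (hA : IntegralStructure.IsDirectProductRegion (fun j => unitBallStructure (K j)) A) :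
    IntegralStructure.weightedLogVolume (fun j => unitBallStructure (K j)) w (fun j => x j • A j) =
      IntegralStructure.weightedLogVolume (fun j => unitBallStructure (K j)) w A +
        ∑ j, w j * mulLogVolume (K j) (x j) := by
  simp only [IntegralStructure.weightedLogVolume_eq_sum, ← Finset.sum_add_distrib, ← mul_add]
  refine Finset.sum_congr rfl fun j _ => ?_
  congr 1
  exact localLogVolume_units_smul (K j) (x j) (hA.pos j) (hA.lt_top _ j)

omit [Fintype J] in
/-- `μ̇_{K}(x)` depends only on `‖x‖`. [cite: MochizukiAbsTopIII2015, Prop. 5.7 (i)(b) p. 138] -/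
theorem mulVolume_eq_of_norm_eq (j : J) {x y : (K j)ˣ} (h : ‖(x : K j)‖ = ‖(y : K j)‖) :
    mulVolume (K j) x = mulVolume (K j) y := by
  rw [mulVolume, mulVolume, units_smul_unitBall, units_smul_unitBall, h]

omit [Fintype J] in
/-- `μ̇^log_{K}(x)` depends only on `‖x‖`. [cite: MochizukiAbsTopIII2015, Prop. 5.7 (i)(b) p. 138] -/
theorem mulLogVolume_eq_of_norm_eq (j : J) {x y : (K j)ˣ} (h : ‖(x : K j)‖ = ‖(y : K j)‖) :
    mulLogVolume (K j) x = mulLogVolume (K j) y := by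
  rw [mulLogVolume, mulLogVolume, mulVolume_eq_of_norm_eq K j h]

omit [Fintype J] in
/-- `μ̇^log_K(x) = −n·log q` whenever `‖x‖ = ‖ϖ‖ⁿ` (`ϖ` a uniformizer, `n ∈ ℤ`).
[cite: MochizukiAbsTopIII2015, Prop. 5.7 (i)(a)(b) pp. 137–138] -/
theorem mulLogVolume_of_norm_eq_zpow (j : J) {ϖ : (K j)ˣ} (hϖ : IsUniformizer ϖ) {x : (K j)ˣ}
    {n : ℤ} (hx : ‖(x : K j)‖ = ‖(ϖ : K j)‖ ^ n) :
    mulLogVolume (K j) x = -(n * Real.log (residueCard (K j))) := by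
  have : ‖(x : K j)‖ = ‖((ϖ ^ n : (K j)ˣ) : K j)‖ := by
    rw [hx, Units.val_zpow_eq_zpow_val, norm_zpow]
  rw [mulLogVolume_eq_of_norm_eq K j this]
  exact mulLogVolume_uniformizer_zpow (K j) hϖ n

omit [Fintype J] in
/-- `μ̇^log_K(p) = −e·f·log p` when `‖p‖ = ‖ϖ‖^e` and `q = p^f` ("`μ^log(p·R_i) = −log p`" before
dividing by the degree `e·f`). [cite: Mochizuki2012, IUTchIV Prop. 1.4 (i) p. 13] -/
theorem mulLogVolume_natCast (j : J) {ϖ : (K j)ˣ} (hϖ : IsUniformizer ϖ) {p e f : ℕ}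
    (hp0 : (p : K j) ≠ 0) (hp : ‖(p : K j)‖ = ‖(ϖ : K j)‖ ^ e) (hq : residueCard (K j) = p ^ f) :
    mulLogVolume (K j) (Units.mk0 (p : K j) hp0) = -(e * f * Real.log p) := by
  have hx : ‖((Units.mk0 (p : K j) hp0 : (K j)ˣ) : K j)‖ = ‖(ϖ : K j)‖ ^ (e : ℤ) := by
    rw [Units.val_mk0, hp, zpow_natCast]
  rw [mulLogVolume_of_norm_eq_zpow K j hϖ hx, hq]
  push_cast
  rw [Real.log_pow]
  ring

/-- **Packet-normalisation** ("normalized so that multiplication … by `p_v` corresponds to adding the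
quantity `−log(p_v)`"): if `‖p‖_{K_j} = ‖ϖ_j‖^{e_j}`, `q_j = p^{f_j}` for every `j` and the weights
satisfy `Σ_j w_j·e_j·f_j = 1`, then multiplying every factor of a direct product region by `p` lowers
its weighted log-volume by exactly `log p`. [cite: Mochizuki2012, IUTchIII Prop. 3.9 (i) p. 115] -/
theorem weightedLogVolume_natCast_smul (w : J → ℝ) {p : ℕ} (hp0 : ∀ j, (p : K j) ≠ 0)
    (ϖ : Π j, (K j)ˣ) (hϖ : ∀ j, IsUniformizer (ϖ j)) (e f : J → ℕ)
    (hp : ∀ j, ‖(p : K j)‖ = ‖(ϖ j : K j)‖ ^ (e j)) (hq : ∀ j, residueCard (K j) = p ^ (f j))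
    (hw : ∑ j, w j * (e j * f j : ℕ) = 1) {A : Π j, Set (K j)}
    (hA : IntegralStructure.IsDirectProductRegion (fun j => unitBallStructure (K j)) A) :
    IntegralStructure.weightedLogVolume (fun j => unitBallStructure (K j)) w
        (fun j => (p : K j) • A j) =
      IntegralStructure.weightedLogVolume (fun j => unitBallStructure (K j)) w A - Real.log p := by
  have h := weightedLogVolume_units_smul K w (fun j => Units.mk0 (p : K j) (hp0 j)) hA
  have hset : (fun j => (Units.mk0 (p : K j) (hp0 j)) • A j) = fun j => (p : K j) • A j := by
    funext j; rfl
  rw [hset] at h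
  rw [h, sub_eq_add_neg]
  congr 1
  have hterm : ∀ j, w j * mulLogVolume (K j) (Units.mk0 (p : K j) (hp0 j)) =
      -(w j * (e j * f j : ℕ) * Real.log p) := fun j => by
    rw [mulLogVolume_natCast K j (hϖ j) (hp0 j) (hp j) (hq j)]
    push_cast
    ring
  simp_rw [hterm, Finset.sum_neg_distrib, ← Finset.sum_mul, hw, one_mul]

/-- In particular `p·O_L = (p·O_{K_j})_j` has packet-normalised log-volume `−log p`
("`μ^log(p·(R_E)^∼) = −log(p)`"). [cite: Mochizuki2012, IUTchIV Prop. 1.4 (i) p. 13] -/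
theorem weightedLogVolume_natCast_smul_unitBall (w : J → ℝ) {p : ℕ} (hp0 : ∀ j, (p : K j) ≠ 0)
    (ϖ : Π j, (K j)ˣ) (hϖ : ∀ j, IsUniformizer (ϖ j)) (e f : J → ℕ)
    (hp : ∀ j, ‖(p : K j)‖ = ‖(ϖ j : K j)‖ ^ (e j)) (hq : ∀ j, residueCard (K j) = p ^ (f j))
    (hw : ∑ j, w j * (e j * f j : ℕ) = 1) :
    IntegralStructure.weightedLogVolume (fun j => unitBallStructure (K j)) w
        (fun j => (p : K j) • closedBall (0 : K j) 1) = -Real.log p := by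
  have h := weightedLogVolume_natCast_smul K w hp0 ϖ hϖ e f hp hq hw
    (IntegralStructure.isDirectProductRegion_self (fun j => unitBallStructure (K j)))
  rw [IntegralStructure.weightedLogVolume_self, zero_sub] at h
  exact h

/-! ### Procession-normalisation -/

/-- **Procession-normalised value**: the average of a finite family of (log-volume) values indexed by
the capsules of a procession ("which we normalize by taking the average, over the various capsules";
Rmk. 3.9.3: "one has no choice but to assign the same weights"). Junk value `0` for an empty family.
[cite: Mochizuki2012, IUTchIII Prop. 3.9 (i) p. 116] -/
def processionAverage {ι : Type*} [Fintype ι] (v : ι → ℝ) : ℝ := (∑ i, v i) / Fintype.card ι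

/-- **Well-definedness**: the procession-normalised value is invariant under relabelling the capsules.
[cite: Mochizuki2012, IUTchIII Rmk. 3.9.3 p. 120] -/
theorem processionAverage_comp_equiv {ι ι' : Type*} [Fintype ι] [Fintype ι'] (σ : ι' ≃ ι)
    (v : ι → ℝ) : processionAverage (v ∘ σ) = processionAverage v := by
  unfold processionAverage
  rw [Fintype.card_congr σ]
  congr 1
  exact Fintype.sum_equiv σ _ _ (fun _ => rfl)

/-- **Compatibility of the two normalisations**: if every capsule contributes the same value `c` (e.g.
`−log p_v` for the packets `p_v·O`), the procession-normalised value is `c`.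
[cite: Mochizuki2012, IUTchIII Prop. 3.9 (i) p. 116] -/
theorem processionAverage_const {ι : Type*} [Fintype ι] [Nonempty ι] (c : ℝ) :
    processionAverage (fun _ : ι => c) = c := by
  unfold processionAverage
  rw [Finset.sum_const, Finset.card_univ, nsmul_eq_mul]
  have : (Fintype.card ι : ℝ) ≠ 0 := by exact_mod_cast Fintype.card_ne_zero
  field_simp

/-- The procession-normalised value is monotone in each capsule's value.
[cite: Mochizuki2012, IUTchIII Prop. 3.9 (i) p. 116] -/
theorem processionAverage_mono {ι : Type*} [Fintype ι] {v v' : ι → ℝ} (h : ∀ i, v i ≤ v' i) :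
    processionAverage v ≤ processionAverage v' :=
  div_le_div_of_nonneg_right (Finset.sum_le_sum fun i _ => h i) (Nat.cast_nonneg _)

/-- The procession-normalised value of a sum is the sum of the procession-normalised values.
[cite: Mochizuki2012, IUTchIII Prop. 3.9 (i) p. 116] -/
theorem processionAverage_add {ι : Type*} [Fintype ι] (v v' : ι → ℝ) :
    processionAverage (v + v') = processionAverage v + processionAverage v' := by
  unfold processionAverage
  rw [← add_div, ← Finset.sum_add_distrib]
  rfl

end Literature.IUT.LogVolume
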